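import Literature.NumberTheory.Automorphic.AdelicGLnGlue
import Mathlib.NumberTheory.NumberField.InfinitePlace.TotallyRealComplex
import Mathlib.Topology.Algebra.Group.Matrix
import HarnessLib

/-!
# The archimedean component of `GL_n(𝔸_K)` for an imaginary quadratic field, read in `ℂ`

Topic `NumberTheory/Automorphic`; namespace `Literature.NumberTheory.Automorphic`, grouping
sub-namespace `ImaginaryQuadratic`.  Definitions with body and their unfolding / inversion
lemmas; tree file `AdelicGLnGlue` (for `GLn.toMixed`, `GLn.ofInfinite`, `GLn.ofFinite`,
`mixedSpaceEvalComplex`) and Mathlib.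

For a TOTALLY COMPLEX number field `K` we fix a complex place `w₀ = complexPlace K` and read the
mixed space `K_∞ ≅ ℝ^{r₁} × ℂ^{r₂}` (`mixedSpace K`) at `w₀`:

* `toComplex K : mixedSpace K →+* ℂ` (= the tree's `mixedSpaceEvalComplex K w₀`), its section
  `ofComplex K : ℂ →+* mixedSpace K` (possible because there is no real place), and — when `K` is
  moreover IMAGINARY QUADRATIC (`finrank ℚ K = 2`: `w₀` is the only place,
  `subsingleton_infinitePlace`, cf. `NumberFields.ImaginaryQuadratic.infinitePlace_eq`) — the ring
  isomorphism `mixedSpaceEquivComplex`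
  (`K ⊗_ℚ ℝ = ℂ`, [ElstrodtGrunewaldMennicke1998, Ch. 7 §7.1]);
* on invertible matrices: `toComplexGL K n : GL_n(𝔸_K) →* GL_n(ℂ)` (archimedean component read at
  `w₀`), its section `ofComplexGL K n : GL_n(ℂ) →* GL_n(𝔸_K)` (`g ↦ (g, 1)`), and the complex
  embedding of the rational points `ratToComplexGL K n : GL_n(K) →* GL_n(ℂ)` through
  `placeEmbedding K = w₀.embedding : K →+* ℂ`;
* the bookkeeping identities: `toComplexGL ∘ ofComplexGL = id`, `(ofComplexGL g)_f = 1`,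
  `toComplexGL (1, h) = 1`, `toComplexGL γ = ratToComplexGL γ` and `γ_f = γ` entrywise for rational
  `γ`, and for imaginary quadratic `K` the reconstruction
  `x = ofComplexGL (toComplexGL x) · (1, x_f)` — i.e. `GL_n(𝔸_K) = GL_n(ℂ) × GL_n(𝔸_K^∞)`
  ([BorelJacquet1979, §4.1]: `G(𝔸) = G_∞ × G(𝔸_f)` with `G_∞ = GL_n(ℂ)` here).

This is the glue through which the adelic reduction theory of the tree (`reductionTheory_gl_holds`,
`siegelFiniteness_gl_holds`) is transported to Bianchi groups acting on hyperbolic `3`-space.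
Nothing topological is asserted beyond `continuous_toComplex`.

## References

* A. Borel, H. Jacquet, *Automorphic forms and automorphic representations*, Proc. Sympos. Pure
  Math. 33 (1979), part 1, §4.1 [BorelJacquet1979].
* J. Elstrodt, F. Grunewald, J. Mennicke, *Groups Acting on Hyperbolic Space* (1998), Ch. 7 §7.1
  [ElstrodtGrunewaldMennicke1998].
-/

noncomputable section

open scoped MatrixGroups
open NumberField NumberField.InfinitePlace NumberField.mixedEmbedding IsDedekindDomain

namespace Literature.NumberTheory.Automorphic

namespace ImaginaryQuadratic

variable (K : Type) [Field K] [NumberField K] [IsTotallyComplex K]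

/-! ### The complex place and the mixed space -/

/-- **A chosen complex place `w₀`** of the totally complex field `K` (any infinite place is
complex). [folklore] -/
def complexPlace : {w : InfinitePlace K // w.IsComplex} :=
  ⟨Classical.arbitrary (InfinitePlace K), IsTotallyComplex.isComplex _⟩

/-- An imaginary quadratic field has a single infinite place (`card = r₁ + r₂ = 0 + 1`; the
statement `NumberFields.ImaginaryQuadratic.infinitePlace_eq` of the tree, as an instance-free
`Subsingleton`). [folklore] -/
theorem subsingleton_infinitePlace (h2 : Module.finrank ℚ K = 2) : Subsingleton (InfinitePlace K) := by
  have h1 := IsTotallyComplex.finrank (K := K)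
  have hc := card_eq_nrRealPlaces_add_nrComplexPlaces (K := K)
  rw [IsTotallyComplex.nrRealPlaces_eq_zero, zero_add] at hc
  have hcard : Fintype.card (InfinitePlace K) = 1 := by omega
  exact Fintype.card_le_one_iff_subsingleton.1 hcard.le

omit [NumberField K] in
/-- A totally complex field has no real place. [folklore] -/
theorem isEmpty_isReal : IsEmpty {w : InfinitePlace K // w.IsReal} :=
  ⟨fun w => (not_isReal_iff_isComplex.2 (IsTotallyComplex.isComplex w.1)) w.2⟩

/-- **Reading the mixed space at `w₀`**: `mixedSpace K →+* ℂ`, `x ↦ x_{w₀}` (the tree's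
`mixedSpaceEvalComplex K w₀`). [cite: BorelJacquet1979, §4.1] -/
def toComplex : mixedSpace K →+* ℂ :=
  mixedSpaceEvalComplex K (complexPlace K)

/-- `toComplex K x = x.2 w₀` (definitional). [folklore] -/
@[simp]
theorem toComplex_apply (x : mixedSpace K) : toComplex K x = x.2 (complexPlace K) := rfl

/-- `toComplex` is `mixedSpaceEvalComplex` at the chosen place (definitional). [folklore] -/
theorem toComplex_eq_mixedSpaceEvalComplex :
    toComplex K = mixedSpaceEvalComplex K (complexPlace K) := rfl

/-- `toComplex` commutes with the involutions (componentwise conjugation on the mixed space).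
[folklore] -/
theorem toComplex_star (x : mixedSpace K) : toComplex K (star x) = star (toComplex K x) := rfl

/-- `toComplex` is continuous. [folklore] -/
theorem continuous_toComplex : Continuous (toComplex K) :=
  (continuous_apply _).comp continuous_snd

/-- Real scalars are read as themselves: `toComplex (r • 1) = r`. [folklore] -/
theorem toComplex_algebraMap (r : ℝ) : toComplex K (algebraMap ℝ (mixedSpace K) r) = r := rfl

/-- **The section `ℂ →+* mixedSpace K`**, `z ↦ ((), (z)_w)`: constant `z` at every complex place,
and the empty family at the (absent) real places. [folklore] -/
def ofComplex : ℂ →+* mixedSpace K where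
  toFun z := ((isEmpty_isReal K).elim, fun _ => z)
  map_one' := Prod.ext (funext fun w => (isEmpty_isReal K).elim w) rfl
  map_mul' _ _ := Prod.ext (funext fun w => (isEmpty_isReal K).elim w) rfl
  map_zero' := Prod.ext (funext fun w => (isEmpty_isReal K).elim w) rfl
  map_add' _ _ := Prod.ext (funext fun w => (isEmpty_isReal K).elim w) rfl

omit [NumberField K] in
/-- `(ofComplex K z).2 w = z` (definitional). [folklore] -/
@[simp]
theorem ofComplex_apply_snd (z : ℂ) (w : {w : InfinitePlace K // w.IsComplex}) :
    (ofComplex K z).2 w = z := rfl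

/-- `toComplex ∘ ofComplex = id`. [folklore] -/
@[simp]
theorem toComplex_ofComplex (z : ℂ) : toComplex K (ofComplex K z) = z := rfl

/-- For an IMAGINARY QUADRATIC field `ofComplex ∘ toComplex = id` (there is only one infinite
place). [cite: ElstrodtGrunewaldMennicke1998, Ch. 7 §7.1] -/
theorem ofComplex_toComplex (h2 : Module.finrank ℚ K = 2) (x : mixedSpace K) :
    ofComplex K (toComplex K x) = x := by
  refine Prod.ext (funext fun w => (isEmpty_isReal K).elim w) (funext fun w => ?_)
  haveI := subsingleton_infinitePlace K h2
  have hw : w = complexPlace K := Subtype.ext (Subsingleton.elim _ _)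
  subst hw
  rfl

/-- **`K ⊗_ℚ ℝ = ℂ` for an imaginary quadratic field**: the mixed space is `ℂ`, read at the
unique infinite place. [cite: ElstrodtGrunewaldMennicke1998, Ch. 7 §7.1] -/
def mixedSpaceEquivComplex (h2 : Module.finrank ℚ K = 2) : mixedSpace K ≃+* ℂ :=
  { toComplex K with
    invFun := ofComplex K
    left_inv := ofComplex_toComplex K h2
    right_inv := toComplex_ofComplex K }

/-- `mixedSpaceEquivComplex` is `toComplex` (definitional). [folklore] -/
@[simp]
theorem mixedSpaceEquivComplex_apply (h2 : Module.finrank ℚ K = 2) (x : mixedSpace K) :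
    mixedSpaceEquivComplex K h2 x = toComplex K x := rfl

/-- For an imaginary quadratic field `toComplex` is injective. [folklore] -/
theorem toComplex_injective (h2 : Module.finrank ℚ K = 2) : Function.Injective (toComplex K) :=
  (mixedSpaceEquivComplex K h2).injective

/-- **The complex embedding `K →+* ℂ` of the chosen place.** [folklore] -/
def placeEmbedding : K →+* ℂ :=
  (complexPlace K).1.embedding

/-- The mixed embedding read at `w₀` is the embedding of `w₀`. [folklore] -/
@[simp]
theorem toComplex_mixedEmbedding (x : K) : toComplex K (mixedEmbedding K x) = placeEmbedding K x :=
  mixedEmbedding_apply_isComplex K x _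

/-- The diagonal embedding `K → K_∞` read at `w₀` (through Mathlib's `ringEquiv_mixedSpace`) is
the embedding of `w₀`. [folklore] -/
theorem toComplex_ringEquiv_mixedSpace_algebraMap (x : K) :
    toComplex K (InfiniteAdeleRing.ringEquiv_mixedSpace K (algebraMap K (InfiniteAdeleRing K) x)) =
      placeEmbedding K x := by
  rw [← InfiniteAdeleRing.mixedEmbedding_eq_algebraMap_comp, toComplex_mixedEmbedding]

/-! ### Invertible matrices -/

variable (n : ℕ)

/-- **The archimedean component of `GL_n(𝔸_K)` read in `GL_n(ℂ)`** (`GLn.toMixed` followed by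
`toComplex` entrywise). [cite: BorelJacquet1979, §4.1] -/
def toComplexGL : GL (Fin n) (AdeleRing (𝓞 K) K) →* GL (Fin n) ℂ :=
  (Matrix.GeneralLinearGroup.map (toComplex K)).comp (GLn.toMixed n K)

/-- **The section `GL_n(ℂ) →* GL_n(𝔸_K)`, `g ↦ (g, 1)`** (`ofComplex` entrywise, then
`GLn.ofInfinite`). [cite: BorelJacquet1979, §4.1] -/
def ofComplexGL : GL (Fin n) ℂ →* GL (Fin n) (AdeleRing (𝓞 K) K) :=
  (GLn.ofInfinite n K).comp (Matrix.GeneralLinearGroup.map (ofComplex K))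

/-- **The rational points in `GL_n(ℂ)`**: `GL_n(K) →* GL_n(ℂ)` through `placeEmbedding`.
[cite: ElstrodtGrunewaldMennicke1998, Ch. 7 §7.1] -/
def ratToComplexGL : GL (Fin n) K →* GL (Fin n) ℂ :=
  Matrix.GeneralLinearGroup.map (placeEmbedding K)

variable {K n}

/-- Entries of `toComplexGL x`: the `w₀`-coordinate of the archimedean part of `x_{ij}`. [folklore] -/
theorem coe_toComplexGL_apply (x : GL (Fin n) (AdeleRing (𝓞 K) K)) (i j : Fin n) :
    (toComplexGL K n x : Matrix (Fin n) (Fin n) ℂ) i j =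
      toComplex K (InfiniteAdeleRing.ringEquiv_mixedSpace K
        (((x : Matrix (Fin n) (Fin n) (AdeleRing (𝓞 K) K)) i j).1)) := rfl

/-- Entries of `toComplexGL` through `GLn.toMixed`. [folklore] -/
theorem coe_toComplexGL_apply' (x : GL (Fin n) (AdeleRing (𝓞 K) K)) (i j : Fin n) :
    (toComplexGL K n x : Matrix (Fin n) (Fin n) ℂ) i j =
      toComplex K ((GLn.toMixed n K x : Matrix (Fin n) (Fin n) (mixedSpace K)) i j) := rfl

/-- Entries of `ratToComplexGL γ`. [folklore] -/
@[simp]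
theorem coe_ratToComplexGL_apply (γ : GL (Fin n) K) (i j : Fin n) :
    (ratToComplexGL K n γ : Matrix (Fin n) (Fin n) ℂ) i j =
      placeEmbedding K ((γ : Matrix (Fin n) (Fin n) K) i j) := rfl

/-- `toComplexGL` factors through `GLn.toMixed` (definitional). [folklore] -/
theorem toComplexGL_apply (x : GL (Fin n) (AdeleRing (𝓞 K) K)) :
    toComplexGL K n x = Matrix.GeneralLinearGroup.map (toComplex K) (GLn.toMixed n K x) := rfl

/-- **`toComplexGL ∘ ofComplexGL = id`.** [cite: BorelJacquet1979, §4.1] -/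
@[simp]
theorem toComplexGL_ofComplexGL (g : GL (Fin n) ℂ) : toComplexGL K n (ofComplexGL K n g) = g := by
  refine Matrix.GeneralLinearGroup.ext fun i j => ?_
  rw [toComplexGL_apply, ofComplexGL, MonoidHom.comp_apply, GLn.toMixed_ofInfinite]
  rfl

/-- **The finite part of `ofComplexGL g` is `1`.** [cite: BorelJacquet1979, §4.1] -/
@[simp]
theorem sndHom_ofComplexGL (g : GL (Fin n) ℂ) : GLn.sndHom n K (ofComplexGL K n g) = 1 := by
  rw [ofComplexGL, MonoidHom.comp_apply, GLn.sndHom_ofInfinite]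

/-- **`toComplexGL (1, h) = 1`** for a finite-adelic `h`. [cite: BorelJacquet1979, §4.1] -/
@[simp]
theorem toComplexGL_ofFinite (h : GL (Fin n) (FiniteAdeleRing (𝓞 K) K)) :
    toComplexGL K n (GLn.ofFinite n K h) = 1 := by
  rw [toComplexGL_apply, GLn.toMixed_ofFinite, map_one]

/-- `ofComplexGL g` and `(1, h)` commute. [cite: BorelJacquet1979, §4.1] -/
theorem commute_ofComplexGL_ofFinite (g : GL (Fin n) ℂ) (h : GL (Fin n) (FiniteAdeleRing (𝓞 K) K)) :
    Commute (ofComplexGL K n g) (GLn.ofFinite n K h) :=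
  GLn.commute_ofInfinite_ofFinite _ _

/-- For an imaginary quadratic field, `GLn.toMixed x` is recovered from `toComplexGL x`.
[folklore] -/
theorem map_ofComplex_toComplexGL (h2 : Module.finrank ℚ K = 2) (x : GL (Fin n) (AdeleRing (𝓞 K) K)) :
    Matrix.GeneralLinearGroup.map (ofComplex K) (toComplexGL K n x) = GLn.toMixed n K x := by
  refine Matrix.GeneralLinearGroup.ext fun i j => ?_
  change ofComplex K (toComplex K ((GLn.toMixed n K x : Matrix (Fin n) (Fin n) (mixedSpace K)) i j)) = _
  rw [ofComplex_toComplex K h2]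

/-- **`GL_n(𝔸_K) = GL_n(ℂ) × GL_n(𝔸_K^∞)` for an imaginary quadratic field**: every `x` is
`ofComplexGL (toComplexGL x) · (1, x_f)`. [cite: BorelJacquet1979, §4.1] -/
theorem ofComplexGL_toComplexGL_mul_ofFinite (h2 : Module.finrank ℚ K = 2)
    (x : GL (Fin n) (AdeleRing (𝓞 K) K)) :
    ofComplexGL K n (toComplexGL K n x) * GLn.ofFinite n K (GLn.sndHom n K x) = x := by
  rw [ofComplexGL, MonoidHom.comp_apply, map_ofComplex_toComplexGL h2,
    GLn.ofInfinite_toMixed_mul_ofFinite_sndHom]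

/-- For an imaginary quadratic field an element of `GL_n(𝔸_K)` is determined by
`toComplexGL` and `GLn.sndHom`. [cite: BorelJacquet1979, §4.1] -/
theorem ext_of_toComplexGL_of_sndHom (h2 : Module.finrank ℚ K = 2)
    {x y : GL (Fin n) (AdeleRing (𝓞 K) K)} (h₁ : toComplexGL K n x = toComplexGL K n y)
    (h₂ : GLn.sndHom n K x = GLn.sndHom n K y) : x = y := by
  rw [← ofComplexGL_toComplexGL_mul_ofFinite h2 x, ← ofComplexGL_toComplexGL_mul_ofFinite h2 y,
    h₁, h₂]

/-- **Rational points: `toComplexGL γ = ratToComplexGL γ`.** [cite: ElstrodtGrunewaldMennicke1998, Ch. 7 §7.1] -/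
@[simp]
theorem toComplexGL_map_algebraMap (γ : GL (Fin n) K) :
    toComplexGL K n (Matrix.GeneralLinearGroup.map (algebraMap K (AdeleRing (𝓞 K) K)) γ) =
      ratToComplexGL K n γ := by
  refine Matrix.GeneralLinearGroup.ext fun i j => ?_
  rw [coe_toComplexGL_apply, coe_ratToComplexGL_apply]
  exact toComplex_ringEquiv_mixedSpace_algebraMap K _

omit [IsTotallyComplex K] in
/-- **Rational points: the finite part of `γ` is `γ`** (entrywise `algebraMap K 𝔸_K^∞`, i.e.
the tree's `BigHeckeGLn.globalEmbedding`). [folklore] -/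
@[simp]
theorem sndHom_map_algebraMap (γ : GL (Fin n) K) :
    GLn.sndHom n K (Matrix.GeneralLinearGroup.map (algebraMap K (AdeleRing (𝓞 K) K)) γ) =
      Matrix.GeneralLinearGroup.map (algebraMap K (FiniteAdeleRing (𝓞 K) K)) γ :=
  Matrix.GeneralLinearGroup.ext fun _ _ => rfl

/-- `toComplexGL` is continuous. [folklore] -/
theorem continuous_toComplexGL : Continuous (toComplexGL K n) :=
  (continuous_toComplex K).generalLinearGroup_map.comp (GLn.continuous_toMixed n K)

end ImaginaryQuadratic

end Literature.NumberTheory.Automorphic
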